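import Summits.QuantumFields.BalabanUV.T4Continuum.Support.NE7LevelMassBudgetGrowth
import HarnessLib

/-!
# NE7LevelMassBudgetAdd — THE ROOT-FORM LEVEL-MASS BUDGET FOR MERELY ADDITIVE LIFTS (the `→+` twin of ✓ `NE7LevelMassBudget.tower_unroll` ∕ `seminorm_tower_le` and
# ✓ `NE7LevelMassBudgetGrowth.levelMassBudget_of_growth`): the curved exact lifts of record ✓ `rTower + dTower` are additive maps (row NE3's `R₀` comes with ✓ `rightInvW0_sub` only)
# (lineage `b2b-balaban-t4-ne7b-p1`, gen 163; route (H′), memo `t4/b2b-balaban-t4-ne7b-p1/g163/records/SCOPING-R4.md` §5; proofs verbatim from the linear twins)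

Cell `pub-balaban`, rung (B)+1 sub-cell t4, lineage `b2b-balaban-t4-ne7b-p1` (row NE7b OWNER + CRUX PROVER; junction service for row NE7), generation 163.
WHAT ([folklore]; 0 def, 0 sorry): `tower_unroll_add`, `seminorm_tower_le_add` (✓ `subadd_sum_le` reused) (any additive group `V`, additive maps), **`levelMassBudget_of_growth_add`** (`L ≥ 2`, `2 ≤ ρ`, `ρ² < L³`):
`Σ_{i≤m} (L³)⁻¹^{m−i}·dirSq (X i) (F i) ≤ (2C̄²∕(1 − ρ²∕L³))·(ρ²·dirSq v (F (m+1)) + 2·Σ_{k≤m} (ρ∕L³)^{m−k}·dirSq (J k) (F k))` for `X i = r_i (X (i+1)) + J i` with additive `r_i` and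
composites `R i k` (`R k k = id`, `r_i ∘ R (i+1) k = R i k`) obeying the root-form composite letters — the shape delivered by ✓ `NE7CurvedExactLiftComposites.curved_composite_le` (`compA`).
HONEST FRAMING (page 1): real∕additive bookkeeping about OUR objects; nothing of Bałaban's asserted; NOT (G3), NOT (G′); spine 0∕9; finite T⁴ rung (B)+1 — NOT infinite volume, NOT mass gap, NOT BetaPertH, NOT Clay.
-/

set_option autoImplicit false

open scoped BigOperators Matrix Matrix.Norms.L2Operator
open Finset

namespace Summit.QuantumFields.BalabanUV.T4Continuum.NE7LevelMassBudgetAdd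

open Literature.MathematicalPhysics.QuantumFieldTheory.Balaban1983to89
open B7Prop1Explicit
open T4AveragingDeficitWall (dirSq)
open NE3LiftDefectCorrection (sqrt_dirSq_add_le)
open NE7LevelMassBudget (dirSq_zero subadd_sum_le)
open NE7LevelMassBudgetGrowth (weighted_sq_sum_le_of_growth)

noncomputable section

/-! ## §1 The unrolled tower and the abstract Minkowski bound for additive maps -/

section Abstract

variable {V : Type*} [AddCommGroup V]

/-- **THE UNROLLED TOWER**: one-step lifts `r_i`, composite lifts `R i k` with `R k k = id` and `r_i ∘ R (i+1) k = R i k` (`i < k`); if `X (m+1) = v` and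
`X i = r_i (X (i+1)) + J i` for `i ≤ m`, then for every `i ≤ m+1`, `X i = R i (m+1) v + Σ_{k ∈ [i, m]} R i k (J k)`. [folklore] -/
theorem tower_unroll_add (r : ℕ → V →+ V) (R : ℕ → ℕ → V →+ V) (hRself : ∀ k, R k k = AddMonoidHom.id V)
    (hRleft : ∀ i k : ℕ, i < k → (r i).comp (R (i + 1) k) = R i k)
    (m : ℕ) (X J : ℕ → V) (v : V) (htop : X (m + 1) = v) (hX : ∀ i ≤ m, X i = r i (X (i + 1)) + J i) :
    ∀ i ≤ m + 1, X i = R i (m + 1) v + ∑ k ∈ Ico i (m + 1), R i k (J k) := by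
  -- downward induction on `t = m + 1 - i`
  suffices h : ∀ t i : ℕ, i + t = m + 1 → X i = R i (m + 1) v + ∑ k ∈ Ico i (m + 1), R i k (J k) by
    intro i hi
    exact h (m + 1 - i) i (by omega)
  intro t
  induction t with
  | zero =>
      intro i hi
      rw [add_zero] at hi
      subst hi
      rw [hRself, Finset.Ico_self, Finset.sum_empty, add_zero, AddMonoidHom.id_apply, htop]
  | succ t ih =>
      intro i hi
      have him : i ≤ m := by omega
      have h1 := ih (i + 1) (by omega)
      rw [hX i him, h1, map_add, map_sum, Finset.sum_eq_sum_Ico_succ_bot (show i < m + 1 by omega), hRself,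
        AddMonoidHom.id_apply]
      have hv : (r i) ((R (i + 1) (m + 1)) v) = R i (m + 1) v := by
        rw [← AddMonoidHom.comp_apply, hRleft i (m + 1) (by omega)]
      have hJ : ∀ k ∈ Ico (i + 1) (m + 1), (r i) ((R (i + 1) k) (J k)) = R i k (J k) := by
        intro k hk
        rw [← AddMonoidHom.comp_apply, hRleft i k (by have := (Finset.mem_Ico.mp hk).1; omega)]
      rw [hv, Finset.sum_congr rfl hJ]
      abel

/-- **THE ABSTRACT MINKOWSKI BOUND OF THE TOWER.**  `p : ℕ → V → ℝ` a family of subadditive functionals vanishing at `0` (level seminorms); tower as in `tower_unroll`;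
COMPOSITE letters on the data actually lifted: `p_i (R i (m+1) v) ≤ C̄·ρ^{m+1−i}·p_{m+1} v` (`i ≤ m+1`) and `p_i (R i k (J k)) ≤ C̄·ρ^{k−i}·p_k (J k)` (`i ≤ k ≤ m`).  Then for
every `i ≤ m+1`: `p_i (X i) ≤ C̄·(ρ^{m+1−i}·p_{m+1} v + Σ_{k∈[i,m]} ρ^{k−i}·p_k (J k))`. [folklore] -/
theorem seminorm_tower_le_add (p : ℕ → V → ℝ) (hp0 : ∀ i, p i 0 = 0) (hp : ∀ i (a b : V), p i (a + b) ≤ p i a + p i b)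
    (r : ℕ → V →+ V) (R : ℕ → ℕ → V →+ V) (hRself : ∀ k, R k k = AddMonoidHom.id V)
    (hRleft : ∀ i k : ℕ, i < k → (r i).comp (R (i + 1) k) = R i k)
    (m : ℕ) (X J : ℕ → V) (v : V) (htop : X (m + 1) = v) (hX : ∀ i ≤ m, X i = r i (X (i + 1)) + J i)
    {Cb ρ : ℝ} (hv : ∀ i ≤ m + 1, p i (R i (m + 1) v) ≤ Cb * ρ ^ (m + 1 - i) * p (m + 1) v)
    (hJ : ∀ i k : ℕ, i ≤ k → k ≤ m → p i (R i k (J k)) ≤ Cb * ρ ^ (k - i) * p k (J k)) :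
    ∀ i ≤ m + 1, p i (X i) ≤ Cb * (ρ ^ (m + 1 - i) * p (m + 1) v + ∑ k ∈ Ico i (m + 1), ρ ^ (k - i) * p k (J k)) := by
  intro i hi
  rw [tower_unroll_add r R hRself hRleft m X J v htop hX i hi]
  refine (hp i _ _).trans ?_
  have h2 : p i (∑ k ∈ Ico i (m + 1), R i k (J k)) ≤ ∑ k ∈ Ico i (m + 1), Cb * ρ ^ (k - i) * p k (J k) :=
    (subadd_sum_le (p i) (hp0 i) (hp i) _ _).trans
      (Finset.sum_le_sum fun k hk => hJ i k (Finset.mem_Ico.mp hk).1 (by have := (Finset.mem_Ico.mp hk).2; omega))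
  have h1 := hv i hi
  rw [mul_add, Finset.mul_sum]
  exact add_le_add (h1.trans (le_of_eq (by ring))) (h2.trans (le_of_eq (Finset.sum_congr rfl fun k _ => by ring)))

end Abstract

/-! ## §2 The growth-tolerant budget -/

variable {d : ℕ} {n : Type*} [Fintype n] [DecidableEq n]

/-- **THE LEVEL-MASS BUDGET, GROWTH-TOLERANT** (`L ≥ 2`, ratio `ρ ≥ 2` with `ρ² < L³` — e.g. `ρ = g·L`, `g² < L`): as `levelMassBudget`, with the composite letters
`√dirSq (R i (m+1) v) (F i) ≤ C̄·ρ^{m+1−i}·√dirSq v (F (m+1))` and `√dirSq (R i k (J k)) (F i) ≤ C̄·ρ^{k−i}·√dirSq (J k) (F k)`: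
`Σ_{i≤m} (L³)⁻¹^{m−i}·dirSq (X i) (F i) ≤ (2C̄²∕(1 − ρ²∕L³))·(ρ²·dirSq v (F (m+1)) + 2·Σ_{k≤m} (ρ∕L³)^{m−k}·dirSq (J k) (F k))`. [folklore] -/
theorem levelMassBudget_of_growth_add {L : ℕ} (hL : 2 ≤ L) {ρ : ℝ} (hρ : 2 ≤ ρ) (hρL : ρ ^ 2 < (L : ℝ) ^ 3) (m : ℕ) (F : ℕ → Finset (Site d))
    (r : ℕ → (Site d → Fin d → Matrix n n ℂ) →+ (Site d → Fin d → Matrix n n ℂ))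
    (R : ℕ → ℕ → (Site d → Fin d → Matrix n n ℂ) →+ (Site d → Fin d → Matrix n n ℂ))
    (hRself : ∀ k, R k k = AddMonoidHom.id _) (hRleft : ∀ i k : ℕ, i < k → (r i).comp (R (i + 1) k) = R i k)
    (X J : ℕ → Site d → Fin d → Matrix n n ℂ) (v : Site d → Fin d → Matrix n n ℂ)
    (htop : X (m + 1) = v) (hX : ∀ i ≤ m, X i = r i (X (i + 1)) + J i) {Cb : ℝ}
    (hv : ∀ i ≤ m + 1, Real.sqrt (dirSq (R i (m + 1) v) (F i)) ≤ Cb * ρ ^ (m + 1 - i) * Real.sqrt (dirSq v (F (m + 1))))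
    (hJ : ∀ i k : ℕ, i ≤ k → k ≤ m → Real.sqrt (dirSq (R i k (J k)) (F i)) ≤ Cb * ρ ^ (k - i) * Real.sqrt (dirSq (J k) (F k))) :
    ∑ i ∈ range (m + 1), (((L : ℝ) ^ 3)⁻¹) ^ (m - i) * dirSq (X i) (F i)
      ≤ (2 * Cb ^ 2 / (1 - ((L : ℝ) ^ 3)⁻¹ * ρ ^ 2))
          * (ρ ^ 2 * dirSq v (F (m + 1)) + 2 * ∑ k ∈ range (m + 1), ((((L : ℝ) ^ 3)⁻¹) * ρ) ^ (m - k) * dirSq (J k) (F k)) := by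
  have hL' : (2 : ℝ) ≤ L := by exact_mod_cast hL
  have hL3 : (0 : ℝ) < (L : ℝ) ^ 3 := by positivity
  have hw : (0 : ℝ) < ((L : ℝ) ^ 3)⁻¹ := by positivity
  have hwρ : ((L : ℝ) ^ 3)⁻¹ * ρ ^ 2 < 1 := by rw [inv_mul_lt_iff₀ hL3]; linarith
  set p : ℕ → (Site d → Fin d → Matrix n n ℂ) → ℝ := fun i Y => Real.sqrt (dirSq Y (F i)) with hp
  have hp0 : ∀ i, p i 0 = 0 := fun i => by simp only [hp]; rw [show (0 : Site d → Fin d → Matrix n n ℂ) = fun _ _ => 0 from rfl, dirSq_zero, Real.sqrt_zero]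
  have hpadd : ∀ i (a b : Site d → Fin d → Matrix n n ℂ), p i (a + b) ≤ p i a + p i b := fun i a b => sqrt_dirSq_add_le a b (F i)
  have hmain := seminorm_tower_le_add p hp0 hpadd r R hRself hRleft m X J v htop hX (Cb := Cb) (ρ := ρ) hv hJ
  have hdir0 : ∀ (Y : Site d → Fin d → Matrix n n ℂ) (G : Finset (Site d)), 0 ≤ dirSq Y G := by
    intro Y G; unfold dirSq; positivity
  have hwres := weighted_sq_sum_le_of_growth hw hρ hwρ m (Real.sqrt_nonneg (dirSq v (F (m + 1)))) (a := fun i => p i (X i)) (b := fun k => p k (J k))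
    (fun i _ => Real.sqrt_nonneg _) (fun k _ => Real.sqrt_nonneg _) (fun i hi => hmain i (by omega))
  simp only [hp, Real.sq_sqrt (hdir0 _ _)] at hwres
  exact hwres

end

end Summit.QuantumFields.BalabanUV.T4Continuum.NE7LevelMassBudgetAdd
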